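import Summits.ABC.ABC.Theorems.FreyModularity.Negative.AbsIrrSqrtFiveFalseWithoutIrreducible
import Literature.NumberTheory.EllipticCurves.SzpiroFreyProofs
import HarnessLib

/-!
# Crux `FreyModularity` (stmt-ABC-11340), line `Sketch`: case B is inhabited —
# the Frey curve of `5 + 27 = 32` has a rational `3`-torsion point

Support file for the crux `Summit.ABC.ABC.Theses.DefiniteXi.FreyModularity` (every Frey curve
`E_(a,b) : y² = x(x - a)(x + b)` is modular), line `Sketch`, registered stub
`stub_freyCaseBWitness` (reshape 7, lead `c52`, side stub S18).  The composition of the line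
(Conrad–Diamond–Taylor 1999, proof of Thm. 7.1.2, p. 556) splits on **case A** — some framed model
of `E[3]` is absolutely irreducible over `ℚ(√-3)` — versus **case B** (none is; Wiles' `3`–`5`
switch).  This file shows that case B is INHABITED on the normalised semistable Frey class
(`A ≡ -1 (mod 4)`, `16 ∣ B`) by the `abc`-triple `5 + 27 = 32`:

* `(a, b) = (-5, 32)` is coprime, `ab(a+b) = -4320 ≠ 0`, `-5 ≡ -1 (mod 4)`, `16 ∣ 32`;
* `freyCurve (-5) 32 = ⟨0, 37, 0, 160, 0⟩`, i.e. `y² = x³ + 37x² + 160x = x(x+5)(x+32)`, carries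
  the rational point `T = (4, 36)`; the tangent slope at `T` is
  `(3·16 + 2·37·4 + 160)/(2·36) = 7`, `x(2T) = 7² - 37 - 8 = 4`, so `2T = (4, -36) = -T` and
  `T` has order `3` (Mathlib's affine group law, `Affine.Point.add_self_of_Y_ne`);
* a rational point of prime order `N` makes `E[N]` reducible (the `Γ_ℚ`-stable line it spans;
  the tree's `not_hasIrreducibleModPGaloisRep_of_addOrderOf_eq`, Mazur 1977, Ch. III §5), while
  a framed model `ρ̄₃` of `E[3]` absolutely irreducible over `ℚ(√-3)` is absolutely irreducible
  (`IsAbsIrreducibleOverSqrt.isAbsolutelyIrreducible`), hence irreducible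
  (`FramedRep.IsAbsolutelyIrreducible.isIrreducible`), hence `E[3]` is irreducible
  (`FreyModularity.Negative.hasIrreducibleModPGaloisRep_of_isIrreducible`) — contradiction.

So the hypotheses of the case-B branch of `isModular_freyCurve_of_stubs` (and of S14
`stub_freyCaseBThreeReducible`) are jointly satisfiable: the switch stub is genuinely consumed.

Nothing is defined (the point `(4, 36)` is built inline); no named fact is used.  What is NOT
here: the conductor (`30`) of the curve, its modularity, or any statement about other triples.

## References

* [Mazur1977] B. Mazur, *Modular curves and the Eisenstein ideal*, Publ. Math. IHÉS 47 (1977),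
  Ch. III §5, p. 157 (a rational `N`-torsion point gives `ρ̄_{E,N}` the Borel shape `(1 *; 0 χ)`).
* [SilvermanAEC2009] J. H. Silverman, *The Arithmetic of Elliptic Curves*, 2nd ed., GTM 106,
  III.2.3 (group law algorithm: duplication formula).
* [DiamondKramer1995] F. Diamond, K. Kramer, Math. Res. Lett. 2 (1995), 299–304, Lemma 1
  (normalisation `A ≡ -1 (mod 4)`, `2 ∣ B`) and Lemma 2 (`16 ∣ B`: semistable at `2`).
-/

-- `Summit.<Summit>.<Problem>` is the mandated summit-side namespace (CONVENTIONS §2); for the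
-- single-conjunct summit `ABC` the two coincide, so the duplicate `ABC.ABC` is deliberate.
set_option linter.dupNamespace false

noncomputable section

open scoped MatrixGroups NumberField

open Matrix Field IsDedekindDomain
open Literature.NumberTheory.EllipticCurves
open Literature.NumberTheory.Automorphic
open Literature.NumberTheory.Automorphic.BCDT
open Literature.NumberTheory.GaloisRepresentations
open WeierstrassCurve

namespace Summit.ABC.ABC.Theorems

/-! ## The rational `3`-torsion point `(4, 36)` of `E_(-5,32) : y² = x(x+5)(x+32)` -/

/-- `(4, 36)` is a nonsingular point of `freyCurve (-5) 32 : y² = x³ + 37x² + 160x`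
(`36² = 1296 = 64 + 592 + 640`; `∂/∂y = 2·36 ≠ 0`). [folklore] -/
theorem nonsingular_freyCurve_negFive_thirtyTwo :
    (freyCurve (-5) 32).toAffine.Nonsingular 4 36 :=
  (Affine.nonsingular_iff' _ _).mpr
    ⟨(Affine.equation_iff _ _).mpr (by norm_num [freyCurve]), Or.inr (by norm_num [freyCurve])⟩

/-- **Duplication of `T = (4, 36)` on `E_(-5,32)`: `T + T = -T`** (tangent slope
`(3·4² + 2·37·4 + 160)/(2·36) = 7`, `x(2T) = 7² - 37 - 4 - 4 = 4`, `y(2T) = -(7·0 + 36) = -36`);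
polymorphic in the `DecidableEq ℚ` instance behind Mathlib's group law.
[cite: SilvermanAEC2009, III.2.3 (group law algorithm, duplication)] -/
theorem freyCurve_negFive_thirtyTwo_T_add_T [DecidableEq ℚ]
    (h : (freyCurve (-5) 32).toAffine.Nonsingular 4 36) :
    Affine.Point.some 4 36 h + Affine.Point.some 4 36 h = -Affine.Point.some 4 36 h := by
  have hy : (36 : ℚ) ≠ (freyCurve (-5) 32).toAffine.negY 4 36 := by
    norm_num [Affine.negY, freyCurve]
  rw [Affine.Point.add_self_of_Y_ne hy, Affine.Point.neg_some]
  congr 1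
  · rw [Affine.slope_of_Y_ne rfl hy]
    norm_num [Affine.addX, Affine.negY, freyCurve]
  · rw [Affine.slope_of_Y_ne rfl hy]
    norm_num [Affine.addY, Affine.negAddY, Affine.addX, Affine.negY, freyCurve]

/-- **`T = (4, 36) ∈ E_(-5,32)(ℚ)` has order `3`**: `3T = 2T + T = -T + T = O` and `T ≠ O`
(`addOrderOf_eq_prime`). [cite: Mazur1977, Ch. III §5, p. 157] -/
theorem addOrderOf_freyCurve_negFive_thirtyTwo_T [DecidableEq ℚ]
    (h : (freyCurve (-5) 32).toAffine.Nonsingular 4 36) :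
    addOrderOf (Affine.Point.some 4 36 h) = 3 := by
  haveI : Fact (Nat.Prime 3) := ⟨Nat.prime_three⟩
  refine addOrderOf_eq_prime ?_ (Affine.Point.some_ne_zero _)
  rw [show (3 : ℕ) = 2 + 1 from rfl, add_nsmul, two_nsmul, one_nsmul,
    freyCurve_negFive_thirtyTwo_T_add_T h, neg_add_cancel]

/-! ## The stub -/

/-- **Registered stub `stub_freyCaseBWitness` (crux `FreyModularity`, line `Sketch`, S18): case B
is inhabited on the semistable Frey class — the triple `5 + 27 = 32`.**  The pair
`(a, b) = (-5, 32)` is coprime (`(-13)(-5) + (-2)·32 = 1`) and normalised (`-5 ≡ -1 (mod 4)`,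
`16 ∣ 32`), `ab(a+b) ≠ 0`, and the Frey curve `E_(-5,32) : y² = x(x+5)(x+32)` carries the rational
point `(4, 36)` of order `3` (`addOrderOf_freyCurve_negFive_thirtyTwo_T`), so `E[3]` has the
`Γ_ℚ`-stable line it generates and is reducible (`not_hasIrreducibleModPGaloisRep_of_addOrderOf_eq`);
a framed model `ρ̄₃` of `E[3]` absolutely irreducible over `ℚ(√-3)` would be absolutely
irreducible (`IsAbsIrreducibleOverSqrt.isAbsolutelyIrreducible`), hence irreducible
(`FramedRep.IsAbsolutelyIrreducible.isIrreducible`), forcing `E[3]` irreducible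
(`FreyModularity.Negative.hasIrreducibleModPGaloisRep_of_isIrreducible`) — contradiction.
[cite: Mazur1977, Ch. III §5, p. 157] -/
theorem stub_freyCaseBWitness :
    IsCoprime (-5 : ℤ) 32 ∧ (-5 : ℤ) * 32 * (-5 + 32) ≠ 0 ∧ (-5 : ℤ) ≡ -1 [ZMOD 4] ∧
      (16 : ℤ) ∣ 32 ∧
      ∀ ρ₃ : ModPGaloisRep ℚ (ZMod 3) 2, (freyCurve (-5) 32).IsTorsionGaloisRep 3 ρ₃ →
        ¬ ρ₃.IsAbsIrreducibleOverSqrt (-3) := by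
  refine ⟨⟨-13, -2, by norm_num⟩, by norm_num, by decide, by norm_num, ?_⟩
  intro ρ₃ hρ habs
  haveI : Fact (Nat.Prime 3) := ⟨Nat.prime_three⟩
  haveI : (freyCurve (-5) 32).IsElliptic := isElliptic_freyCurve (by norm_num)
  have hirr : FramedRep.IsIrreducible ρ₃ := habs.isAbsolutelyIrreducible.isIrreducible
  exact not_hasIrreducibleModPGaloisRep_of_addOrderOf_eq (freyCurve (-5) 32)
    (addOrderOf_freyCurve_negFive_thirtyTwo_T nonsingular_freyCurve_negFive_thirtyTwo)
    (FreyModularity.Negative.hasIrreducibleModPGaloisRep_of_isIrreducible hρ hirr)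

end Summit.ABC.ABC.Theorems

end
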